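import Mathlib
import Literature.Analysis.FunctionSpaces.NuclearSpace
import Summits.AnomalousDissipation.AnomalousDissipation.Theorems.LimitingAbsorptionFloorUpgradeStubCosTransformNonneg
import HarnessLib

/-!
# Negative knowledge for the crux `FloorUpgrade` (stmt-AnomalousDissipation-15010), II:
# in the slow regime the kernel axiomatics of line `SketchIdeator1` give NO floor

Route `route-AnomalousDissipation-LimitingAbsorption`, crux r4 `…Theses.LimitingAbsorption.FloorUpgrade`;
supports stmt-AnomalousDissipation-15010 (refuter / crux-disprover lane; no route statement concluded).

The abstract FIRST LEMMA of the picked line (`zeroFrequencyFloor`, composed of stubs A1–A4 in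
`Cruxes/FloorUpgrade/Lines/SketchIdeator1.lean`) floors the zero-frequency mass `∫₀^∞ C` of an even,
continuous, positive-definite lag kernel `C` with exponential envelope `|C| ≤ A e^{-γ|τ|}` and
short-lag bound `C(0) - C(τ) ≤ δ|τ| + C(0)Λ²τ²/2`, PROVIDED the FAST inequality
`4 (A/C(0))^{1/3} Λ ≤ γ` holds. Part I (`FastClassEmpty`) shows that no relaxing family is fast
(transport speed limit). This file shows that the fast inequality is load-bearing in the strongest
sense: WITHOUT it, the remaining kernel axiomatics (even, continuous, positive-definite, exponential
envelope, quadratic short-lag bound, `δ = 0`) are compatible with `∫₀^∞ C = 0` EXACTLY: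

* `slowKernel τ = (1 - τ²/2) e^{-τ²/4} = (τ e^{-τ²/4})'` — the characteristic function of the
  finite measure `2x² · N(0, 1/2)(dx)` (so positive-definite by the easy half of Bochner,
  `Literature.Analysis.FunctionSpaces.isPositiveDefinite_charFun`, and Mathlib's
  `iteratedDeriv_charFun` / `charFun_gaussianReal`), with `slowKernel 0 = 1`,
  `|slowKernel τ| ≤ 15 e^{-|τ|}`, `1 - slowKernel τ ≤ (3/4) τ²` and `∫₀^∞ slowKernel = 0`
  (`exists_pd_kernel_zero_mass`);
* `zeroFrequencyFloor_false_without_fast`: the statement of `zeroFrequencyFloor` with the single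
  hypothesis `hfast` deleted is FALSE (witness `slowKernel`, `A = 15`, `γ = 1`, `Λ = √(3/2)`, `δ = 0`).

Consequence for the crux: in the only non-empty regime (`γ ≲ Λ log C`, Part I) a Green–Kubo floor
cannot come from {positive-definiteness, envelope from `(U_h)`, curvature from the mean energy}; any
proof of `FloorUpgrade` along this card must feed in NEW information on the lag kernel (its negative
part / its spectral density near the sweeping frequencies).

## References

* S. Bochner, Math. Ann. 108 (1933), §1 (positive-definite functions, easy half). [`Bochner1933`]
-/

noncomputable section

open MeasureTheory ProbabilityTheory Set Filter Topology Complex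
open scoped ComplexConjugate NNReal BigOperators

namespace Summit.AnomalousDissipation.AnomalousDissipation.Theorems.FloorUpgrade.Negative

set_option linter.dupNamespace false -- D-0017: `Summit.<S>.<S>.…` namespace by design

open Literature.Analysis.FunctionSpaces

/-! ## The kernel -/

/-- The slow-regime kernel `K(τ) = (1 - τ²/2) e^{-τ²/4}`. [folklore] -/
def slowKernel (τ : ℝ) : ℝ := (1 - τ ^ 2 / 2) * Real.exp (-(τ ^ 2 / 4))

/-- `K(0) = 1`. [folklore] -/
theorem slowKernel_zero : slowKernel 0 = 1 := by simp [slowKernel]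

/-- `K` is even. [folklore] -/
theorem slowKernel_neg (τ : ℝ) : slowKernel (-τ) = slowKernel τ := by simp [slowKernel]

/-- `K` is continuous. [folklore] -/
theorem continuous_slowKernel : Continuous slowKernel := by
  unfold slowKernel; fun_prop

/-- The inner exponent: `(−σ²/4)' = −σ/2`. [folklore] -/
theorem hasDerivAt_negSqDiv (s : ℝ) : HasDerivAt (fun σ : ℝ => -(σ ^ 2 / 4)) (-(s / 2)) s := by
  have h : HasDerivAt (fun σ : ℝ => -(σ ^ 2 / 4)) (-(((2 : ℕ) : ℝ) * s ^ (2 - 1) / 4)) s :=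
    ((hasDerivAt_pow 2 s).div_const 4).neg
  exact h.congr_deriv (by push_cast; ring)

/-- `K` is the derivative of `τ e^{-τ²/4}`. [folklore] -/
theorem hasDerivAt_mul_exp (τ : ℝ) :
    HasDerivAt (fun σ : ℝ => σ * Real.exp (-(σ ^ 2 / 4))) (slowKernel τ) τ := by
  have h2 : HasDerivAt (fun σ : ℝ => Real.exp (-(σ ^ 2 / 4)))
      (Real.exp (-(τ ^ 2 / 4)) * (-(τ / 2))) τ := (hasDerivAt_negSqDiv τ).exp
  have h3 : HasDerivAt (fun σ : ℝ => σ * Real.exp (-(σ ^ 2 / 4)))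
      (1 * Real.exp (-(τ ^ 2 / 4)) + τ * (Real.exp (-(τ ^ 2 / 4)) * (-(τ / 2)))) τ :=
    (hasDerivAt_id' τ).mul h2
  exact h3.congr_deriv (by simp only [slowKernel]; ring)

/-- Short-lag bound: `1 - K(τ) ≤ (3/4) τ²` (`1 - e^{-x} ≤ x`, `e^{-x} ≤ 1`). [folklore] -/
theorem one_sub_slowKernel_le (τ : ℝ) : 1 - slowKernel τ ≤ 3 * τ ^ 2 / 4 := by
  unfold slowKernel
  set x : ℝ := τ ^ 2 / 4 with hx
  have hx0 : 0 ≤ x := by positivity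
  have he1 : Real.exp (-x) ≤ 1 := by rw [Real.exp_le_one_iff]; linarith
  have he2 : 1 - x ≤ Real.exp (-x) := by linarith [Real.add_one_le_exp (-x)]
  have he0 : 0 ≤ Real.exp (-x) := (Real.exp_pos _).le
  have : τ ^ 2 / 2 = 2 * x := by rw [hx]; ring
  rw [this]
  nlinarith [mul_nonneg hx0 he0]

/-- Envelope: `|K(τ)| ≤ 15 e^{-|τ|}` (`|τ| - τ²/8 ≤ 2`, `(1 + 4w) e^{-w} ≤ 2`, `e² < 15/2`). [folklore] -/
theorem abs_slowKernel_le (τ : ℝ) : |slowKernel τ| ≤ 15 * Real.exp (-(1 * |τ|)) := by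
  unfold slowKernel
  set w : ℝ := τ ^ 2 / 8 with hw
  have hw0 : 0 ≤ w := by positivity
  have hsq : τ ^ 2 = |τ| ^ 2 := (sq_abs τ).symm
  -- `|1 - τ²/2| ≤ 1 + 4w`
  have h1 : |1 - τ ^ 2 / 2| ≤ 1 + 4 * w := by
    rw [abs_le]; constructor <;> nlinarith [sq_nonneg τ]
  -- `(1 + 4w) e^{-w} ≤ 2`
  have h2 : (1 + 4 * w) * Real.exp (-w) ≤ 2 := by
    have hexp : 1 + w + w ^ 2 / 2 ≤ Real.exp w := by
      have := Real.quadratic_le_exp_of_nonneg hw0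
      linarith
    have hpos : 0 < Real.exp w := Real.exp_pos w
    rw [Real.exp_neg, ← div_eq_mul_inv, div_le_iff₀ hpos]
    nlinarith [sq_nonneg (w - 1)]
  -- `e^{-τ²/4} = e^{-w} e^{-w}` and `e^{-w} ≤ e^{2} e^{-|τ|}`
  have h3 : Real.exp (-(τ ^ 2 / 4)) = Real.exp (-w) * Real.exp (-w) := by
    rw [← Real.exp_add]; congr 1; rw [hw]; ring
  have h4 : Real.exp (-w) ≤ Real.exp 2 * Real.exp (-(1 * |τ|)) := by
    rw [← Real.exp_add, Real.exp_le_exp]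
    have : |τ| - |τ| ^ 2 / 8 ≤ 2 := by nlinarith [sq_nonneg (|τ| - 4)]
    rw [hw, hsq]; linarith
  have h5 : Real.exp 2 ≤ 15 / 2 := by
    have := Real.exp_one_lt_d9
    have e2 : Real.exp 2 = Real.exp 1 * Real.exp 1 := by rw [← Real.exp_add]; norm_num
    rw [e2]; nlinarith [Real.exp_pos (1 : ℝ)]
  rw [abs_mul, abs_of_pos (Real.exp_pos _), h3]
  have hA : 0 ≤ Real.exp (-w) := (Real.exp_pos _).le
  have hB : 0 ≤ Real.exp (-(1 * |τ|)) := (Real.exp_pos _).le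
  calc |1 - τ ^ 2 / 2| * (Real.exp (-w) * Real.exp (-w))
      = (|1 - τ ^ 2 / 2| * Real.exp (-w)) * Real.exp (-w) := by ring
    _ ≤ ((1 + 4 * w) * Real.exp (-w)) * (Real.exp 2 * Real.exp (-(1 * |τ|))) := by
        gcongr
    _ ≤ 2 * (15 / 2 * Real.exp (-(1 * |τ|))) := by gcongr
    _ = 15 * Real.exp (-(1 * |τ|)) := by ring

/-- `K` is integrable on `ℝ`. [folklore] -/
theorem integrable_slowKernel : Integrable slowKernel :=
  Summit.AnomalousDissipation.AnomalousDissipation.Theorems.FloorUpgradeLine.CosTransformNonneg.integrable_of_abs_le_exp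
    slowKernel 15 1
    continuous_slowKernel one_pos abs_slowKernel_le

/-- Zero mass on the half-line: `∫₀^∞ K = 0` (`K = (τ e^{-τ²/4})'`, which vanishes at `0` and at
`∞`). [folklore] -/
theorem integral_Ioi_slowKernel : ∫ τ in Ioi (0 : ℝ), slowKernel τ = 0 := by
  have hlim : Tendsto (fun σ : ℝ => σ * Real.exp (-(σ ^ 2 / 4))) atTop (𝓝 0) := by
    have h0 := Real.tendsto_pow_mul_exp_neg_atTop_nhds_zero 1
    refine tendsto_of_tendsto_of_tendsto_of_le_of_le' tendsto_const_nhds h0 ?_ ?_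
    · filter_upwards [eventually_ge_atTop 0] with σ hσ
      exact mul_nonneg hσ (Real.exp_pos _).le
    · filter_upwards [eventually_ge_atTop 4] with σ hσ
      rw [pow_one]
      refine mul_le_mul_of_nonneg_left (Real.exp_le_exp.2 ?_) (by linarith)
      nlinarith
  have h := integral_Ioi_of_hasDerivAt_of_tendsto (a := 0) (m := 0)
    (f := fun σ : ℝ => σ * Real.exp (-(σ ^ 2 / 4))) (f' := slowKernel)
    (by fun_prop) (fun τ _ => hasDerivAt_mul_exp τ) integrable_slowKernel.integrableOn hlim
  simpa using h

/-! ## Positive-definiteness: `K` is the characteristic function of `2x² · N(0, 1/2)` -/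

/-- The Gaussian `N(0, 1/2)` weighted by `2x²` (a finite measure of total mass `1`). [folklore] -/
def slowMeasure : Measure ℝ :=
  (gaussianReal 0 ((1 : ℝ≥0) / 2)).withDensity fun x => ENNReal.ofReal (2 * x ^ 2)

/-- `2x² · N(0,1/2)` is a finite measure (second Gaussian moment). [folklore] -/
instance slowMeasure_isFiniteMeasure : IsFiniteMeasure slowMeasure := by
  unfold slowMeasure
  refine isFiniteMeasure_withDensity_ofReal ?_
  have h : Integrable (fun x : ℝ => 2 * x ^ 2) (gaussianReal 0 ((1 : ℝ≥0) / 2)) := by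
    have h2 := (memLp_id_gaussianReal (μ := 0) (v := (1 : ℝ≥0) / 2) 2).integrable_norm_pow
      (by norm_num)
    refine (h2.const_mul 2).congr (Eventually.of_forall fun x => ?_)
    simp [sq_abs]
  exact h.hasFiniteIntegral

/-- The characteristic function of `N(0, 1/2)` is `e^{-t²/4}`. [folklore] -/
theorem charFun_gauss_half (t : ℝ) :
    charFun (gaussianReal 0 ((1 : ℝ≥0) / 2)) t = cexp (((-(t ^ 2 / 4) : ℝ) : ℂ)) := by
  rw [charFun_gaussianReal]
  congr 1
  have hv : (((1 : ℝ≥0) / 2 : ℝ≥0) : ℝ) = 1 / 2 := by norm_num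
  rw [hv]
  push_cast
  ring

/-- The second derivative of `t ↦ e^{-t²/4}` (complex-valued): `(t²/4 - 1/2) e^{-t²/4}`. [folklore] -/
theorem iteratedDeriv_two_cexp (t : ℝ) :
    iteratedDeriv 2 (fun s : ℝ => cexp (((-(s ^ 2 / 4) : ℝ) : ℂ))) t =
      (((t ^ 2 / 4 - 1 / 2 : ℝ)) : ℂ) * cexp (((-(t ^ 2 / 4) : ℝ) : ℂ)) := by
  -- first derivative
  have hr : ∀ s : ℝ, HasDerivAt (fun σ : ℝ => -(σ ^ 2 / 4)) (-(s / 2)) s := hasDerivAt_negSqDiv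
  have h1 : ∀ s : ℝ, HasDerivAt (fun σ : ℝ => cexp (((-(σ ^ 2 / 4) : ℝ) : ℂ)))
      (cexp (((-(s ^ 2 / 4) : ℝ) : ℂ)) * (((-(s / 2) : ℝ)) : ℂ)) s := fun s =>
    ((hr s).ofReal_comp).cexp
  have hd1 : deriv (fun σ : ℝ => cexp (((-(σ ^ 2 / 4) : ℝ) : ℂ))) =
      fun s => cexp (((-(s ^ 2 / 4) : ℝ) : ℂ)) * (((-(s / 2) : ℝ)) : ℂ) :=
    funext fun s => (h1 s).deriv
  -- second derivative
  have hl : ∀ s : ℝ, HasDerivAt (fun σ : ℝ => (((-(σ / 2) : ℝ)) : ℂ)) ((((-(1 / 2 : ℝ)) : ℝ) : ℂ)) s := by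
    intro s
    have : HasDerivAt (fun σ : ℝ => -(σ / 2)) (-(1 / 2)) s := ((hasDerivAt_id' s).div_const 2).neg
    exact this.ofReal_comp
  have h2 : HasDerivAt (fun s : ℝ => cexp (((-(s ^ 2 / 4) : ℝ) : ℂ)) * (((-(s / 2) : ℝ)) : ℂ))
      (cexp (((-(t ^ 2 / 4) : ℝ) : ℂ)) * (((-(t / 2) : ℝ)) : ℂ) * (((-(t / 2) : ℝ)) : ℂ) +
        cexp (((-(t ^ 2 / 4) : ℝ) : ℂ)) * ((((-(1 / 2 : ℝ)) : ℝ) : ℂ))) t := (h1 t).mul (hl t)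
  rw [iteratedDeriv_succ, iteratedDeriv_one, hd1, h2.deriv]
  push_cast
  ring

/-- **`K` is a characteristic function**: `charFun (2x² · N(0,1/2)) = K`. [folklore] -/
theorem charFun_slowMeasure (t : ℝ) : charFun slowMeasure t = ((slowKernel t : ℝ) : ℂ) := by
  have hmem : MemLp id 2 (gaussianReal 0 ((1 : ℝ≥0) / 2)) := by
    simpa using memLp_id_gaussianReal (μ := 0) (v := (1 : ℝ≥0) / 2) 2
  -- unfold the density
  have h1 : charFun slowMeasure t =
      ∫ x, (2 * x ^ 2 : ℝ) • cexp (t * x * I) ∂(gaussianReal 0 ((1 : ℝ≥0) / 2)) := by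
    rw [charFun_apply_real, slowMeasure, integral_withDensity_eq_integral_toReal_smul (by fun_prop)
      (Eventually.of_forall fun x => ENNReal.ofReal_lt_top)]
    refine integral_congr_ae (Eventually.of_forall fun x => ?_)
    show (ENNReal.ofReal (2 * x ^ 2)).toReal • cexp (↑t * ↑x * I) = (2 * x ^ 2 : ℝ) • cexp (↑t * ↑x * I)
    rw [ENNReal.toReal_ofReal (by positivity)]
  -- the second moment integral is `-(charFun)''`
  have h2 : ∫ x, (2 * x ^ 2 : ℝ) • cexp (t * x * I) ∂(gaussianReal 0 ((1 : ℝ≥0) / 2)) =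
      2 * ∫ x, (x : ℂ) ^ 2 * cexp (t * x * I) ∂(gaussianReal 0 ((1 : ℝ≥0) / 2)) := by
    rw [← integral_const_mul]
    refine integral_congr_ae (Eventually.of_forall fun x => ?_)
    show (2 * x ^ 2 : ℝ) • cexp (↑t * ↑x * I) = 2 * ((x : ℂ) ^ 2 * cexp (↑t * ↑x * I))
    rw [real_smul]
    push_cast
    ring
  have h3 := iteratedDeriv_charFun (μ := gaussianReal 0 ((1 : ℝ≥0) / 2)) (n := 2) (t := t) hmem
  have h4 : (fun s => charFun (gaussianReal 0 ((1 : ℝ≥0) / 2)) s) =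
      fun s : ℝ => cexp (((-(s ^ 2 / 4) : ℝ) : ℂ)) := funext charFun_gauss_half
  have h5 : ∫ x, (x : ℂ) ^ 2 * cexp (t * x * I) ∂(gaussianReal 0 ((1 : ℝ≥0) / 2)) =
      -(iteratedDeriv 2 (charFun (gaussianReal 0 ((1 : ℝ≥0) / 2))) t) := by
    rw [h3, I_sq]; ring
  rw [h1, h2, h5, show (charFun (gaussianReal 0 ((1 : ℝ≥0) / 2))) =
      fun s => charFun (gaussianReal 0 ((1 : ℝ≥0) / 2)) s from rfl, h4, iteratedDeriv_two_cexp]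
  simp only [slowKernel]
  push_cast
  ring

/-- **`K` is positive-definite** in the real finite-sum sense of the line's stubs. [folklore] -/
theorem slowKernel_posDef (n : ℕ) (τ c : Fin n → ℝ) :
    0 ≤ ∑ i, ∑ j, c i * c j * slowKernel (τ i - τ j) := by
  have h := (isPositiveDefinite_charFun slowMeasure n τ (fun i => (c i : ℂ))).1
  have e : (∑ i, ∑ j, conj ((c i : ℂ)) * (c j : ℂ) * charFun slowMeasure (τ j - τ i)).re =
      ∑ i, ∑ j, c i * c j * slowKernel (τ i - τ j) := by
    rw [Complex.re_sum]
    refine Finset.sum_congr rfl fun i _ => ?_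
    rw [Complex.re_sum]
    refine Finset.sum_congr rfl fun j _ => ?_
    rw [charFun_slowMeasure, Complex.conj_ofReal, show τ j - τ i = -(τ i - τ j) by ring,
      slowKernel_neg]
    norm_cast
  rwa [e] at h

/-! ## The theorems -/

/-- **A positive-definite kernel with envelope, curvature bound and ZERO zero-frequency mass.**
There is an even continuous `K`, positive-definite in the finite-sum sense, with `K(0) = 1`,
`|K(τ)| ≤ 15 e^{-|τ|}`, `K(0) - K(τ) ≤ 0·|τ| + K(0)·(3/2)·τ²/2`, and `∫₀^∞ K = 0`. [folklore] -/
theorem exists_pd_kernel_zero_mass : ∃ K : ℝ → ℝ, Continuous K ∧ (∀ τ, K (-τ) = K τ) ∧ K 0 = 1 ∧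
    (∀ τ, |K τ| ≤ 15 * Real.exp (-(1 * |τ|))) ∧
    (∀ τ, K 0 - K τ ≤ 0 * |τ| + K 0 * Real.sqrt (3 / 2) ^ 2 * τ ^ 2 / 2) ∧
    (∀ (n : ℕ) (τ c : Fin n → ℝ), 0 ≤ ∑ i, ∑ j, c i * c j * K (τ i - τ j)) ∧
    ∫ τ in Ioi (0 : ℝ), K τ = 0 := by
  refine ⟨slowKernel, continuous_slowKernel, slowKernel_neg, slowKernel_zero, abs_slowKernel_le,
    fun τ => ?_, slowKernel_posDef, integral_Ioi_slowKernel⟩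
  rw [slowKernel_zero, Real.sq_sqrt (by norm_num)]
  have := one_sub_slowKernel_le τ
  linarith

/-- **In the slow regime the zero-frequency floor fails**: the statement of the line's
`zeroFrequencyFloor` (stubs A1–A4 composed) with the single hypothesis
`hfast : 4 (A / C 0)^{1/3} Λ ≤ γ` deleted is FALSE — witnessed by `slowKernel` with `A = 15`, `γ = 1`,
`Λ = √(3/2)`, `δ = 0`, whose zero-frequency mass vanishes. So `hfast` is load-bearing, and by Part I
(`fastRelaxingFamily_false_of_ballistic`) it is never met by a relaxing family: positive-definiteness +
`(U_h)`-envelope + energy-curvature cannot floor the absorbed power. [folklore] -/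
theorem zeroFrequencyFloor_false_without_fast :
    ¬ ∀ (C : ℝ → ℝ) (A γ Λ δ : ℝ), Continuous C → 0 < γ → 0 < Λ → 0 < C 0 → C 0 ≤ A → 0 ≤ δ →
      δ ≤ C 0 * Λ / 6 → (∀ τ, C (-τ) = C τ) → (∀ τ, |C τ| ≤ A * Real.exp (-(γ * |τ|))) →
      (∀ τ, C 0 - C τ ≤ δ * |τ| + C 0 * Λ ^ 2 * τ ^ 2 / 2) →
      (∀ (n : ℕ) (τ c : Fin n → ℝ), 0 ≤ ∑ i, ∑ j, c i * c j * C (τ i - τ j)) →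
      C 0 / (8 * Λ) ≤ ∫ τ in Ioi (0 : ℝ), C τ := by
  intro H
  have hΛ : 0 < Real.sqrt (3 / 2) := Real.sqrt_pos.2 (by norm_num)
  have h := H slowKernel 15 1 (Real.sqrt (3 / 2)) 0 continuous_slowKernel one_pos hΛ
    (by rw [slowKernel_zero]; norm_num) (by rw [slowKernel_zero]; norm_num) le_rfl
    (by rw [slowKernel_zero]; positivity) slowKernel_neg abs_slowKernel_le
    (fun τ => by
      rw [slowKernel_zero, Real.sq_sqrt (by norm_num)]
      have := one_sub_slowKernel_le τ
      linarith)
    slowKernel_posDef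
  rw [integral_Ioi_slowKernel, slowKernel_zero] at h
  have : (0 : ℝ) < 1 / (8 * Real.sqrt (3 / 2)) := by positivity
  linarith

end Summit.AnomalousDissipation.AnomalousDissipation.Theorems.FloorUpgrade.Negative

end
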